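import Summits.Ventures.CertifiedManyBodySolver.Observables.MeanFieldClassExclusionLaOverdoped
import Literature.MathematicalPhysics.QuantumLattice.HubbardFermiSeaTangentRowsLowB
import HarnessLib

/-!
# Ventures/CertifiedManyBodySolver — Observables/MeanFieldClassExclusionLaLowUB.lean

HONEST FRAMING: first certified bounds; not a superconductivity verdict; every number certified or labelled float.
A competing-order EXCLUSION removes a named class of candidate ground states; it never says which order is present;
no phase sentence follows.

Cell `hubbard-tc` (MO-S3, D-0096), seat `hubbard-tc-mod-3` (G3), `prover-hubbard-tc-mod-3-g4-0`. File 2/2 of the RE-THRESHOLD of the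
La₂₋ₓSrₓCuO₄ MF/BCS-class words at the new S1 box edge `U/t_eff = 5.9` (§OF-RECORD v1.10 of `BOXES/La2CuO4-family.md`; companion of
`MeanFieldClassExclusionLaLowU.lean`, which holds the x = 0 / 0.07 / 0.05 / 0.03 columns and the PUBLIC devices). This file is
SELF-CONTAINED: §1 repeats the devices it needs as `private` theorems (same statements, same proofs) because the build farm could not
serve the compiled `MeanFieldClassExclusionLaLowU` module at filing time (a successor may switch to the import — a pure-proof edit).
For every torus limit `ω` of unit `(rectN n L, S^z = 0)`-sector ground states of `hubbardTorusTT' L 1 t′ U`, `Re ω(n_{0↑} n_{0↓}) < (n/2)²`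
(no non-magnetic Hartree–Fock / singlet-BCS ground state — Wick) on:

* x = ⅛    (M15, `n ∈ [0.855, 0.895]`, `t′ ∈ [−3/10, −1/5]`): EVERY `U ≥ 5.9` (`laLow_x0125_docc_lt_of`, cond. #498 ∧ #445 ∧ #472; margin `+0.13`) —
  supersedes `laBox_docc_lt_sq_half_density_of` (`[7, 15]`) for box coverage;
* x = 0.15 (M16, `n ∈ [0.83, 0.87]`):  EVERY `U ≥ 5.9` (`laLow_x015_docc_lt_of`, cond. #498 ∧ #445; `+0.087`);
* x = 0.22 (M17, `n ∈ [0.76, 0.80]`):  EVERY `U ≥ 6`   (`laLow_x022_docc_lt_of`, cond. #498 ∧ #445 ∧ #473; `+0.018`) — the sliver `[5.9, 6)` of the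
  box stays «undetermined-MF» (exact margin `+0.008` at `5.9`, not filed);
* x = 0.30 (#50, `n ∈ [0.68, 0.72]`, `t′ ∈ [−1/4, −1/10]` ⊇ the box face `[−0.23, −0.13]`): EVERY `U ≥ 7` (`laLow_x030_docc_lt_of`, cond.
  #498 ∧ #445 ∧ #472; `+0.019`; was `7.5`, `laE_x030_docc_lt_of`) — the strip `[5.9, 7)` is NOT covered by any device of record (best exact
  margin `−0.003` at `6.5`): «undetermined-MF» there.

Caps = density chords (convexity in `n`, ring-normalised) of the CERTIFIED #445 anchor at `(8, 7/8, −1/4)` transported in `t′` by the decimal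
kinematic law and down in `U` by monotonicity, or the `t′`-chord cap `objE_conc78_cap8` (#445 ∧ #473) on `t′ ≤ −1/4`, the CERTIFIED
quarter-filling cap #498, and the half-filling cap #472; floors = tangent Fermi-sea rows touching inside each band
(`HubbardFermiSeaTangentRowsLowB` / `…Low` / `…LscoColumns` / `…TangentRows`) read between columns by concavity (`objE_floor_between`); the
bilinear `(n, t′)` chord terms are closed by `nlinarith` with the four McCormick products of each leaf rectangle (corner-exact); the class
constant `(n/2)²` is read above its tangent at the lower band edge. Exact designer: `hubbard-tc-mod-3/g4-replay/lowU_plan.py`.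
WHAT THIS IS NOT: a statement about stripes, d-wave order or T_c; the saturated-FM class; tight; a phase word.

References: T. Koma, H. Tasaki, J. Stat. Phys. 76 (1994) 745, §1 [KomaTasaki1994]; V. Bach, E. H. Lieb, J. P. Solovej,
J. Stat. Phys. 76 (1994) 3, eq. (2c.36) [BachLiebSolovej1994]; E. H. Lieb, M. Loss, Duke Math. J. 71 (1993) 337, §8 Thm 8.2
[LiebLoss1993]; R. B. Israel, Convexity in the Theory of Lattice Gases (1979), Thm I.3.4 [Israel1979]; D. Ruelle,
Statistical Mechanics (1969) §3.3 [Ruelle1969].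
-/

noncomputable section

namespace Summit.Ventures.CertifiedManyBodySolver.Observables

open Literature.MathematicalPhysics.QuantumLattice
open Literature.MathematicalPhysics.QuantumLattice.ThermodynamicLimit
open Summit.Ventures.CertifiedManyBodySolver.Certificates
open Matrix HubbardWave0 Literature.Probability.LatticeModels Filter Topology
open scoped ComplexOrder BigOperators


/-! ### §1 Devices (PRIVATE copies of the `MeanFieldClassExclusionLaLowU.lean` devices — that module could not be imported on the build farm at filing time; same statements and proofs) -/

/-- **The docc tail with a cap at `U_c` and a threshold `U₁ ≤ U_c`**: a cap `e(1, t′, U_c, n) ≤ u`, a free floor `ℓ ≤ e(1, t′, 0, n)` and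
ONE linear margin `u − ℓ < (n/2)²·U₁` (`0 < U₁ ≤ U_c`) give `Re ω(n_{0↑}n_{0↓}) < (n/2)²` for every GS torus limit at every `U ≥ U₁` — below
`U_c` the cap holds by monotonicity in `U`, above it grows at most with the Hartree–Fock Lipschitz slope `(n/2)²`
(`energyDensityTT'_ge_sub_mul_sq_U`), which cancels against the class floor `ℓ + U(n/2)²` (the general-`U_c` form of `doccN_lt_of_cap8_threshold`).
[cite: KomaTasaki1994, §1] [cite: BachLiebSolovej1994, eq. (2c.36)] -/
private theorem lowUB_doccN_lt_of_capUc_threshold {t' U Uc n u ℓ U₁ : ℝ} (hU₁ : 0 < U₁) (hU₁c : U₁ ≤ Uc) (hU : U₁ ≤ U)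
    (hn0 : 0 ≤ n) (hn2 : n < 2) (hcap : energyDensityTT' 1 t' Uc n ≤ u) (hℓ : ℓ ≤ energyDensityTT' 1 t' 0 n)
    (hlin : u - ℓ < (n / 2) ^ 2 * U₁) :
    ∀ (ω : InfVolFermionState 2) (Ls : ℕ → ℕ) (ψ : ∀ L, Fock (Orb (FermionTorus 2 L))),
      Tendsto Ls atTop atTop →
      (∀ j, IsGroundStateInSector (hubbardTorusTT' (Ls j) 1 t' U) (rectN n (Ls j)) 0 (ψ (Ls j))) →
      (∀ j, star (ψ (Ls j)) ⬝ᵥ ψ (Ls j) = 1) → ω.IsTorusLimitOf ψ Ls →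
      (ω.expect ({0} : Finset (Site 2))
        (nAt 0 (Finset.mem_singleton_self 0) 0 * nAt 0 (Finset.mem_singleton_self 0) 1)).re < (n / 2) ^ 2 := by
  have hU0 : 0 < U := lt_of_lt_of_le hU₁ hU
  have hUc0 : 0 ≤ Uc := le_trans hU₁.le hU₁c
  have hsq : 0 ≤ (n / 2) ^ 2 := sq_nonneg _
  have hlinU : u - ℓ < (n / 2) ^ 2 * U := lt_of_lt_of_le hlin (mul_le_mul_of_nonneg_left hU hsq)
  rcases le_total U Uc with hle | hle
  · have hm := energyDensityTT'_mono_U 1 t' hn0 hn2 hU0.le hle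
    exact doccN_lt_of_cap_of_floor hU0 hn0 hn2 (hm.trans hcap) hℓ hlinU
  · have hq := energyDensityTT'_ge_sub_mul_sq_U 1 t' hn0 hn2 hUc0 hle
    have hcapU : energyDensityTT' 1 t' U n ≤ u + (U - Uc) * (n / 2) ^ 2 := by linarith
    refine doccN_lt_of_cap_of_floor hU0 hn0 hn2 hcapU hℓ ?_
    have hlinc : u - ℓ < (n / 2) ^ 2 * Uc := lt_of_lt_of_le hlin (mul_le_mul_of_nonneg_left hU₁c hsq)
    have e : u + (U - Uc) * (n / 2) ^ 2 - ℓ = (u - ℓ - (n / 2) ^ 2 * Uc) + (n / 2) ^ 2 * U := by ring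
    rw [e]
    linarith

/-- **The `7/8` anchor, near side** (`−1/4 ≤ s`, `0 ≤ U_c ≤ 8`): `e(1, s, U_c, 7/8) ≤ −0.2813417849 + 1.6212·s` — CERTIFIED #445 at
`(8, 7/8, −1/4)` transported by `1.6212·|s + 1/4|` and down in `U` by monotonicity. [cite: Israel1979, Thm. I.3.4] -/
private theorem lowUB_cap78_near (h445 : cert_dbt329pair_allk) {s Uc : ℝ} (hUc0 : 0 ≤ Uc) (hUc8 : Uc ≤ 8) (hs : -1 / 4 ≤ s) :
    energyDensityTT' 1 s Uc (7 / 8) ≤ -0.2813417849 + 1.6212 * s := by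
  have hR := m3_tpm1o4_cap_decimal_of h445
  have h := energyDensityTT'_tPrime_transport_ge_decimal 1 (by norm_num : (0 : ℝ) ≤ 8)
    (by norm_num : (0 : ℝ) ≤ 7 / 8) (by norm_num : (7 / 8 : ℝ) < 2) s (-1 / 4)
  rw [show (-1 / 4 : ℝ) - s = -(s + 1 / 4) by ring, abs_neg, abs_of_nonneg (by linarith : 0 ≤ s + 1 / 4)] at h
  have hm := energyDensityTT'_mono_U 1 s (n := 7 / 8) (by norm_num) (by norm_num) hUc0 hUc8
  linarith

/-- **The `7/8` anchor, far side** (`s ≤ −1/4`, `0 ≤ U_c ≤ 8`): `e(1, s, U_c, 7/8) ≤ −1.0919417849 − 1.6212·s`. [cite: Israel1979, Thm. I.3.4] -/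
private theorem lowUB_cap78_far (h445 : cert_dbt329pair_allk) {s Uc : ℝ} (hUc0 : 0 ≤ Uc) (hUc8 : Uc ≤ 8) (hs : s ≤ -1 / 4) :
    energyDensityTT' 1 s Uc (7 / 8) ≤ -1.0919417849 - 1.6212 * s := by
  have hR := m3_tpm1o4_cap_decimal_of h445
  have h := energyDensityTT'_tPrime_transport_ge_decimal 1 (by norm_num : (0 : ℝ) ≤ 8)
    (by norm_num : (0 : ℝ) ≤ 7 / 8) (by norm_num : (7 / 8 : ℝ) < 2) s (-1 / 4)
  rw [abs_of_nonneg (by linarith : 0 ≤ (-1 / 4 : ℝ) - s)] at h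
  have hm := energyDensityTT'_mono_U 1 s (n := 7 / 8) (by norm_num) (by norm_num) hUc0 hUc8
  linarith

/-- **The quarter-filling anchor at `U_c ≤ 8`** (`s ≤ 0`): `e(1, s, U_c, 1/2) ≤ −0.9916692317 − 1.6212·s` (CERTIFIED #498, kinematic
transport, monotonicity in `U`). [cite: Israel1979, Thm. I.3.4] -/
private theorem lowUB_quarter_cap (h498 : cert_r498_qfp_U8_n1o2_tp0_upper) {s Uc : ℝ} (hUc0 : 0 ≤ Uc) (hUc8 : Uc ≤ 8) (hs : s ≤ 0) :
    energyDensityTT' 1 s Uc (1 / 2) ≤ -0.9916692317 - 1.6212 * s := by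
  have h := laE_quarter_cap_at (laE_quarter_cap_decimal_of h498) hs
  have hm := energyDensityTT'_mono_U 1 s (n := 1 / 2) (by norm_num) (by norm_num) hUc0 hUc8
  exact hm.trans h

/-- **Density chord `7/8 → 1`** (ring-normalised): caps `e(1, s, U, 7/8) ≤ A`, `e(1, s, U, 1) ≤ C`, `7/8 < n < 1` give
`e(1, s, U, n) ≤ 8[(1 − n)A + (n − 7/8)C]`. [cite: Ruelle1969, §3.3] -/
private theorem lowUB_chord_78_one {s U n A C : ℝ} (hU : 0 ≤ U) (hA : energyDensityTT' 1 s U (7 / 8) ≤ A)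
    (hC : energyDensityTT' 1 s U 1 ≤ C) (h1 : 7 / 8 < n) (h2 : n < 1) :
    energyDensityTT' 1 s U n ≤ 8 * ((1 - n) * A + (n - 7 / 8) * C) := by
  have hd := energyDensityTT'_le_density_chord 1 s hU (n₁ := 7 / 8) (n := n) (n₂ := 1)
    (by norm_num) h1 h2 (by norm_num) hA hC
  have e1 : ((1 - n) * A + (n - 7 / 8) * C) / (1 - 7 / 8) = 8 * ((1 - n) * A + (n - 7 / 8) * C) := by ring
  rw [e1] at hd
  exact hd

/-- **Density chord `1/2 → 7/8`**: caps `e(1, s, U, 1/2) ≤ H`, `e(1, s, U, 7/8) ≤ A`, `1/2 < n < 7/8` give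
`e(1, s, U, n) ≤ (8/3)[(7/8 − n)H + (n − 1/2)A]`. [cite: Ruelle1969, §3.3] -/
private theorem lowUB_chord_half_78 {s U n H A : ℝ} (hU : 0 ≤ U) (hH : energyDensityTT' 1 s U (1 / 2) ≤ H)
    (hA : energyDensityTT' 1 s U (7 / 8) ≤ A) (h1 : 1 / 2 < n) (h2 : n < 7 / 8) :
    energyDensityTT' 1 s U n ≤ 8 / 3 * ((7 / 8 - n) * H + (n - 1 / 2) * A) := by
  have hd := energyDensityTT'_le_density_chord 1 s hU (n₁ := 1 / 2) (n := n) (n₂ := 7 / 8)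
    (by norm_num) h1 h2 (by norm_num) hH hA
  have e1 : ((7 / 8 - n) * H + (n - 1 / 2) * A) / (7 / 8 - 1 / 2) = 8 / 3 * ((7 / 8 - n) * H + (n - 1 / 2) * A) := by ring
  rw [e1] at hd
  exact hd

/-- **Density chord `1/2 → 1`**: caps `e(1, s, U, 1/2) ≤ H`, `e(1, s, U, 1) ≤ C`, `1/2 < n < 1` give
`e(1, s, U, n) ≤ 2[(1 − n)H + (n − 1/2)C]`. [cite: Ruelle1969, §3.3] -/
private theorem lowUB_chord_half_one {s U n H C : ℝ} (hU : 0 ≤ U) (hH : energyDensityTT' 1 s U (1 / 2) ≤ H)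
    (hC : energyDensityTT' 1 s U 1 ≤ C) (h1 : 1 / 2 < n) (h2 : n < 1) :
    energyDensityTT' 1 s U n ≤ 2 * ((1 - n) * H + (n - 1 / 2) * C) := by
  have hd := energyDensityTT'_le_density_chord 1 s hU (n₁ := 1 / 2) (n := n) (n₂ := 1)
    (by norm_num) h1 h2 (by norm_num) hH hC
  have e1 : ((1 - n) * H + (n - 1 / 2) * C) / (1 - 1 / 2) = 2 * ((1 - n) * H + (n - 1 / 2) * C) := by ring
  rw [e1] at hd
  exact hd



/-! ### §2 The words -/

/-- **La₁.₈₇₅Sr₀.₁₂₅CuO₄ (M15, the validation annex column), OBJECT E, `n ∈ [0.855, 0.895]` — MF/BCS class excluded on the WHOLE new box:** `t′ ∈ [−3/10, −1/5]`, EVERY `U ≥ 5.9` (was `[7, 15]`, `laBox_docc_lt_sq_half_density_of`). Caps at `U_c = 8`: chord `1/2 → 7/8` (#498, #445) below `7/8`, the #445 anchor at `7/8`, chord `7/8 → 1` (#445, #472) above; floor = tangent rows at `n₀ = 7/8`; smallest margin `+0.13`. [cite: KomaTasaki1994, §1] [cite: BachLiebSolovej1994, eq. (2c.36)] [cite: LiebLoss1993,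 §8, Theorem 8.2] -/
theorem laLow_x0125_docc_lt_of (h498 : cert_r498_qfp_U8_n1o2_tp0_upper) (h445 : cert_dbt329pair_allk)
    (h472 : cert_r472_pb2_tl_upper_n1_U8)
    {t' U n : ℝ} (ht1 : -3 / 10 ≤ t') (ht2 : t' ≤ -1 / 5) (hU : 59 / 10 ≤ U)
    (hn1 : 171 / 200 ≤ n) (hn2 : n ≤ 179 / 200) :
    ∀ (ω : InfVolFermionState 2) (Ls : ℕ → ℕ) (ψ : ∀ L, Fock (Orb (FermionTorus 2 L))),
      Tendsto Ls atTop atTop →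
      (∀ j, IsGroundStateInSector (hubbardTorusTT' (Ls j) 1 t' U) (rectN n (Ls j)) 0 (ψ (Ls j))) →
      (∀ j, star (ψ (Ls j)) ⬝ᵥ ψ (Ls j) = 1) → ω.IsTorusLimitOf ψ Ls →
      (ω.expect ({0} : Finset (Site 2))
        (nAt 0 (Finset.mem_singleton_self 0) 0 * nAt 0 (Finset.mem_singleton_self 0) 1)).re < (n / 2) ^ 2 := by
  have hn0 : (0 : ℝ) ≤ n := by linarith
  have hn2' : n < 2 := by linarith
  -- the class constant `(n/2)²` above its tangent at the lower band edge, scaled by the threshold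
  have hsq : (-29241 / 160000 : ℝ) + 171 / 400 * n ≤ (n / 2) ^ 2 := by nlinarith [sq_nonneg (n - 171 / 200)]
  have hsqU : ((-29241 / 160000 : ℝ) + 171 / 400 * n) * (59 / 10) ≤ (n / 2) ^ 2 * (59 / 10) :=
    mul_le_mul_of_nonneg_right hsq (by norm_num)
  have h8 : (0 : ℝ) ≤ 8 := by norm_num
  have hC := objE_halfFilling_cap8 h472 t'
  have hH := lowUB_quarter_cap h498 h8 le_rfl (by linarith : t' ≤ 0)
  have ra := fermiSeaTangentRow_tPrime_neg_three_div_ten_at_seven_div_eight (U := 0) le_rfl hn0 hn2'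
  have rb := fermiSeaTangentRow_tPrime_neg_one_div_four_at_seven_div_eight (U := 0) le_rfl hn0 hn2'
  have rc := fermiSeaTangentRow_tPrime_neg_one_div_five_at_seven_div_eight (U := 0) le_rfl hn0 hn2'
  rcases le_or_gt t' (-1 / 4) with hp | hp
  · -- piece `[-3/10, -1/4]`: far-side anchor
    have hA := lowUB_cap78_far h445 h8 le_rfl hp
    have hfl := objE_floor_between hn0 hn2' (by norm_num : (-3 / 10 : ℝ) ≤ -1 / 4) ra rb ht1 hp
    rcases lt_trichotomy n (7 / 8) with hlt | heq | hgt
    · have hcap := lowUB_chord_half_78 (n := n) h8 hH hA (by linarith) hlt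
      exact lowUB_doccN_lt_of_capUc_threshold (U₁ := 59 / 10) (Uc := 8) (by norm_num) (by norm_num) hU hn0 hn2' hcap hfl
        (sub_min_lt_of
          (by nlinarith only [mul_nonneg (sub_nonneg.2 hn1) (sub_nonneg.2 ht1), mul_nonneg (sub_nonneg.2 hn1) (sub_nonneg.2 hp),
          mul_nonneg (sub_nonneg.2 (le_of_lt hlt)) (sub_nonneg.2 ht1), mul_nonneg (sub_nonneg.2 (le_of_lt hlt)) (sub_nonneg.2 hp), hsqU, hn1, (le_of_lt hlt), ht1, hp])
          (by nlinarith only [mul_nonneg (sub_nonneg.2 hn1) (sub_nonneg.2 ht1), mul_nonneg (sub_nonneg.2 hn1) (sub_nonneg.2 hp),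
          mul_nonneg (sub_nonneg.2 (le_of_lt hlt)) (sub_nonneg.2 ht1), mul_nonneg (sub_nonneg.2 (le_of_lt hlt)) (sub_nonneg.2 hp), hsqU, hn1, (le_of_lt hlt), ht1, hp]))
    · subst heq
      have hcap := hA
      exact lowUB_doccN_lt_of_capUc_threshold (U₁ := 59 / 10) (Uc := 8) (by norm_num) (by norm_num) hU hn0 hn2' hcap hfl
        (sub_min_lt_of (by linarith) (by linarith))
    · have hcap := lowUB_chord_78_one (n := n) h8 hA hC hgt (by linarith)
      exact lowUB_doccN_lt_of_capUc_threshold (U₁ := 59 / 10) (Uc := 8) (by norm_num) (by norm_num) hU hn0 hn2' hcap hfl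
        (sub_min_lt_of
          (by nlinarith only [mul_nonneg (sub_nonneg.2 (le_of_lt hgt)) (sub_nonneg.2 ht1), mul_nonneg (sub_nonneg.2 (le_of_lt hgt)) (sub_nonneg.2 hp),
          mul_nonneg (sub_nonneg.2 hn2) (sub_nonneg.2 ht1), mul_nonneg (sub_nonneg.2 hn2) (sub_nonneg.2 hp), hsqU, (le_of_lt hgt), hn2, ht1, hp])
          (by nlinarith only [mul_nonneg (sub_nonneg.2 (le_of_lt hgt)) (sub_nonneg.2 ht1), mul_nonneg (sub_nonneg.2 (le_of_lt hgt)) (sub_nonneg.2 hp),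
          mul_nonneg (sub_nonneg.2 hn2) (sub_nonneg.2 ht1), mul_nonneg (sub_nonneg.2 hn2) (sub_nonneg.2 hp), hsqU, (le_of_lt hgt), hn2, ht1, hp]))
  · -- piece `(-1/4, -1/5]`: near-side anchor
    have hA := lowUB_cap78_near h445 h8 le_rfl hp.le
    have hfl := objE_floor_between hn0 hn2' (by norm_num : (-1 / 4 : ℝ) ≤ -1 / 5) rb rc hp.le ht2
    rcases lt_trichotomy n (7 / 8) with hlt | heq | hgt
    · have hcap := lowUB_chord_half_78 (n := n) h8 hH hA (by linarith) hlt
      exact lowUB_doccN_lt_of_capUc_threshold (U₁ := 59 / 10) (Uc := 8) (by norm_num) (by norm_num) hU hn0 hn2' hcap hfl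
        (sub_min_lt_of
          (by nlinarith only [mul_nonneg (sub_nonneg.2 hn1) (sub_nonneg.2 (le_of_lt hp)), mul_nonneg (sub_nonneg.2 hn1) (sub_nonneg.2 ht2),
          mul_nonneg (sub_nonneg.2 (le_of_lt hlt)) (sub_nonneg.2 (le_of_lt hp)), mul_nonneg (sub_nonneg.2 (le_of_lt hlt)) (sub_nonneg.2 ht2), hsqU, hn1, (le_of_lt hlt), (le_of_lt hp), ht2])
          (by nlinarith only [mul_nonneg (sub_nonneg.2 hn1) (sub_nonneg.2 (le_of_lt hp)), mul_nonneg (sub_nonneg.2 hn1) (sub_nonneg.2 ht2),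
          mul_nonneg (sub_nonneg.2 (le_of_lt hlt)) (sub_nonneg.2 (le_of_lt hp)), mul_nonneg (sub_nonneg.2 (le_of_lt hlt)) (sub_nonneg.2 ht2), hsqU, hn1, (le_of_lt hlt), (le_of_lt hp), ht2]))
    · subst heq
      have hcap := hA
      exact lowUB_doccN_lt_of_capUc_threshold (U₁ := 59 / 10) (Uc := 8) (by norm_num) (by norm_num) hU hn0 hn2' hcap hfl
        (sub_min_lt_of (by linarith) (by linarith))
    · have hcap := lowUB_chord_78_one (n := n) h8 hA hC hgt (by linarith)
      exact lowUB_doccN_lt_of_capUc_threshold (U₁ := 59 / 10) (Uc := 8) (by norm_num) (by norm_num) hU hn0 hn2' hcap hfl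
        (sub_min_lt_of
          (by nlinarith only [mul_nonneg (sub_nonneg.2 (le_of_lt hgt)) (sub_nonneg.2 (le_of_lt hp)), mul_nonneg (sub_nonneg.2 (le_of_lt hgt)) (sub_nonneg.2 ht2),
          mul_nonneg (sub_nonneg.2 hn2) (sub_nonneg.2 (le_of_lt hp)), mul_nonneg (sub_nonneg.2 hn2) (sub_nonneg.2 ht2), hsqU, (le_of_lt hgt), hn2, (le_of_lt hp), ht2])
          (by nlinarith only [mul_nonneg (sub_nonneg.2 (le_of_lt hgt)) (sub_nonneg.2 (le_of_lt hp)), mul_nonneg (sub_nonneg.2 (le_of_lt hgt)) (sub_nonneg.2 ht2),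
          mul_nonneg (sub_nonneg.2 hn2) (sub_nonneg.2 (le_of_lt hp)), mul_nonneg (sub_nonneg.2 hn2) (sub_nonneg.2 ht2), hsqU, (le_of_lt hgt), hn2, (le_of_lt hp), ht2]))

/-- **La₁.₈₅Sr₀.₁₅CuO₄ (M16), OBJECT E, `n ∈ [0.83, 0.87]` — MF/BCS class excluded on the WHOLE new box:** `t′ ∈ [−3/10, −1/5]`, EVERY `U ≥ 5.9`. Cap at `U_c = 8` = chord `1/2 → 7/8` (#498, #445); floor = tangent rows at `n₀ = 17/20`; smallest margin `+0.087`. [cite: KomaTasaki1994, §1] [cite: BachLiebSolovej1994, eq. (2c.36)] [cite: LiebLoss1993, §8, Theorem 8.2] -/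
theorem laLow_x015_docc_lt_of (h498 : cert_r498_qfp_U8_n1o2_tp0_upper) (h445 : cert_dbt329pair_allk)
    {t' U n : ℝ} (ht1 : -3 / 10 ≤ t') (ht2 : t' ≤ -1 / 5) (hU : 59 / 10 ≤ U)
    (hn1 : 83 / 100 ≤ n) (hn2 : n ≤ 87 / 100) :
    ∀ (ω : InfVolFermionState 2) (Ls : ℕ → ℕ) (ψ : ∀ L, Fock (Orb (FermionTorus 2 L))),
      Tendsto Ls atTop atTop →
      (∀ j, IsGroundStateInSector (hubbardTorusTT' (Ls j) 1 t' U) (rectN n (Ls j)) 0 (ψ (Ls j))) →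
      (∀ j, star (ψ (Ls j)) ⬝ᵥ ψ (Ls j) = 1) → ω.IsTorusLimitOf ψ Ls →
      (ω.expect ({0} : Finset (Site 2))
        (nAt 0 (Finset.mem_singleton_self 0) 0 * nAt 0 (Finset.mem_singleton_self 0) 1)).re < (n / 2) ^ 2 := by
  have hn0 : (0 : ℝ) ≤ n := by linarith
  have hn2' : n < 2 := by linarith
  -- the class constant `(n/2)²` above its tangent at the lower band edge, scaled by the threshold
  have hsq : (-6889 / 40000 : ℝ) + 83 / 200 * n ≤ (n / 2) ^ 2 := by nlinarith [sq_nonneg (n - 83 / 100)]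
  have hsqU : ((-6889 / 40000 : ℝ) + 83 / 200 * n) * (59 / 10) ≤ (n / 2) ^ 2 * (59 / 10) :=
    mul_le_mul_of_nonneg_right hsq (by norm_num)
  have h8 : (0 : ℝ) ≤ 8 := by norm_num
  have hH := lowUB_quarter_cap h498 h8 le_rfl (by linarith : t' ≤ 0)
  have ra := fermiSeaTangentRow_tPrime_neg_three_div_ten_at_seventeen_div_twenty (U := 0) le_rfl hn0 hn2'
  have rb := fermiSeaTangentRow_tPrime_neg_one_div_four_at_seventeen_div_twenty (U := 0) le_rfl hn0 hn2'
  have rc := fermiSeaTangentRow_tPrime_neg_one_div_five_at_seventeen_div_twenty (U := 0) le_rfl hn0 hn2'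
  rcases le_or_gt t' (-1 / 4) with hp | hp
  · -- piece `[-3/10, -1/4]`
    have hA := lowUB_cap78_far h445 h8 le_rfl hp
    have hcap := lowUB_chord_half_78 (n := n) h8 hH hA (by linarith) (by linarith)
    have hfl := objE_floor_between hn0 hn2' (by norm_num : (-3 / 10 : ℝ) ≤ -1 / 4) ra rb ht1 hp
    exact lowUB_doccN_lt_of_capUc_threshold (U₁ := 59 / 10) (Uc := 8) (by norm_num) (by norm_num) hU hn0 hn2' hcap hfl
      (sub_min_lt_of
        (by nlinarith only [mul_nonneg (sub_nonneg.2 hn1) (sub_nonneg.2 ht1), mul_nonneg (sub_nonneg.2 hn1) (sub_nonneg.2 hp),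
          mul_nonneg (sub_nonneg.2 hn2) (sub_nonneg.2 ht1), mul_nonneg (sub_nonneg.2 hn2) (sub_nonneg.2 hp), hsqU, hn1, hn2, ht1, hp])
        (by nlinarith only [mul_nonneg (sub_nonneg.2 hn1) (sub_nonneg.2 ht1), mul_nonneg (sub_nonneg.2 hn1) (sub_nonneg.2 hp),
          mul_nonneg (sub_nonneg.2 hn2) (sub_nonneg.2 ht1), mul_nonneg (sub_nonneg.2 hn2) (sub_nonneg.2 hp), hsqU, hn1, hn2, ht1, hp]))
  · -- piece `(-1/4, -1/5]`
    have hA := lowUB_cap78_near h445 h8 le_rfl hp.le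
    have hcap := lowUB_chord_half_78 (n := n) h8 hH hA (by linarith) (by linarith)
    have hfl := objE_floor_between hn0 hn2' (by norm_num : (-1 / 4 : ℝ) ≤ -1 / 5) rb rc hp.le ht2
    exact lowUB_doccN_lt_of_capUc_threshold (U₁ := 59 / 10) (Uc := 8) (by norm_num) (by norm_num) hU hn0 hn2' hcap hfl
      (sub_min_lt_of
        (by nlinarith only [mul_nonneg (sub_nonneg.2 hn1) (sub_nonneg.2 (le_of_lt hp)), mul_nonneg (sub_nonneg.2 hn1) (sub_nonneg.2 ht2),
          mul_nonneg (sub_nonneg.2 hn2) (sub_nonneg.2 (le_of_lt hp)), mul_nonneg (sub_nonneg.2 hn2) (sub_nonneg.2 ht2), hsqU, hn1, hn2, (le_of_lt hp), ht2])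
        (by nlinarith only [mul_nonneg (sub_nonneg.2 hn1) (sub_nonneg.2 (le_of_lt hp)), mul_nonneg (sub_nonneg.2 hn1) (sub_nonneg.2 ht2),
          mul_nonneg (sub_nonneg.2 hn2) (sub_nonneg.2 (le_of_lt hp)), mul_nonneg (sub_nonneg.2 hn2) (sub_nonneg.2 ht2), hsqU, hn1, hn2, (le_of_lt hp), ht2]))

/-- **La₁.₇₈Sr₀.₂₂CuO₄ (M17), OBJECT E, `n ∈ [0.76, 0.80]` — MF/BCS class excluded from `U = 6`:** `t′ ∈ [−3/10, −1/5]`, EVERY `U ≥ 6` (box `[5.9, 14.7]`; the sliver `[5.9, 6)` is not covered: exact margin `+0.008` at `5.9`, not filed). Cap at `U_c = 8` = chord `1/2 → 7/8` with the `t′`-chord cap `objE_conc78_cap8` on `t′ ≤ −1/4` and the kinematic anchor on `t′ ≥ −1/4`; floor = tangent rows at `n₀ = 39/50`; smallest margin `+0.018`. [cite: KomaTasaki1994, §1] [cite: BachLiebSolovej1994, eq. (2c.36)] [cite: LiebLoss1993, §8, Theorem 8.2] -/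
theorem laLow_x022_docc_lt_of (h498 : cert_r498_qfp_U8_n1o2_tp0_upper) (h445 : cert_dbt329pair_allk)
    (h473 : cert_r473_bs_M3U8tp0_w3_b4_R2_ob5p2_kry1_kry2c3rel_hanK7B4D4_KN4_PR20d4_hanK8c2s_hanK8B4D4_uprime)
    {t' U n : ℝ} (ht1 : -3 / 10 ≤ t') (ht2 : t' ≤ -1 / 5) (hU : 6 ≤ U)
    (hn1 : 19 / 25 ≤ n) (hn2 : n ≤ 4 / 5) :
    ∀ (ω : InfVolFermionState 2) (Ls : ℕ → ℕ) (ψ : ∀ L, Fock (Orb (FermionTorus 2 L))),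
      Tendsto Ls atTop atTop →
      (∀ j, IsGroundStateInSector (hubbardTorusTT' (Ls j) 1 t' U) (rectN n (Ls j)) 0 (ψ (Ls j))) →
      (∀ j, star (ψ (Ls j)) ⬝ᵥ ψ (Ls j) = 1) → ω.IsTorusLimitOf ψ Ls →
      (ω.expect ({0} : Finset (Site 2))
        (nAt 0 (Finset.mem_singleton_self 0) 0 * nAt 0 (Finset.mem_singleton_self 0) 1)).re < (n / 2) ^ 2 := by
  have hn0 : (0 : ℝ) ≤ n := by linarith
  have hn2' : n < 2 := by linarith
  -- the class constant `(n/2)²` above its tangent at the lower band edge, scaled by the threshold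
  have hsq : (-361 / 2500 : ℝ) + 19 / 50 * n ≤ (n / 2) ^ 2 := by nlinarith [sq_nonneg (n - 19 / 25)]
  have hsqU : ((-361 / 2500 : ℝ) + 19 / 50 * n) * (6) ≤ (n / 2) ^ 2 * (6) :=
    mul_le_mul_of_nonneg_right hsq (by norm_num)
  have h8 : (0 : ℝ) ≤ 8 := by norm_num
  have hH := lowUB_quarter_cap h498 h8 le_rfl (by linarith : t' ≤ 0)
  have ra := fermiSeaTangentRow_tPrime_neg_three_div_ten_at_thirtynine_div_fifty (U := 0) le_rfl hn0 hn2'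
  have rb := fermiSeaTangentRow_tPrime_neg_one_div_four_at_thirtynine_div_fifty (U := 0) le_rfl hn0 hn2'
  have rc := fermiSeaTangentRow_tPrime_neg_one_div_five_at_thirtynine_div_fifty (U := 0) le_rfl hn0 hn2'
  rcases le_or_gt t' (-1 / 4) with hp | hp
  · -- piece `[-3/10, -1/4]`: the `t′`-chord cap of the `7/8` anchor (#445 ∧ #473)
    have hA := objE_conc78_cap8 h445 h473 (s := t') hp
    have hcap := lowUB_chord_half_78 (n := n) h8 hH hA (by linarith) (by linarith)
    have hfl := objE_floor_between hn0 hn2' (by norm_num : (-3 / 10 : ℝ) ≤ -1 / 4) ra rb ht1 hp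
    exact lowUB_doccN_lt_of_capUc_threshold (U₁ := 6) (Uc := 8) (by norm_num) (by norm_num) hU hn0 hn2' hcap hfl
      (sub_min_lt_of
        (by nlinarith only [mul_nonneg (sub_nonneg.2 hn1) (sub_nonneg.2 ht1), mul_nonneg (sub_nonneg.2 hn1) (sub_nonneg.2 hp),
          mul_nonneg (sub_nonneg.2 hn2) (sub_nonneg.2 ht1), mul_nonneg (sub_nonneg.2 hn2) (sub_nonneg.2 hp), hsqU, hn1, hn2, ht1, hp])
        (by nlinarith only [mul_nonneg (sub_nonneg.2 hn1) (sub_nonneg.2 ht1), mul_nonneg (sub_nonneg.2 hn1) (sub_nonneg.2 hp),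
          mul_nonneg (sub_nonneg.2 hn2) (sub_nonneg.2 ht1), mul_nonneg (sub_nonneg.2 hn2) (sub_nonneg.2 hp), hsqU, hn1, hn2, ht1, hp]))
  · -- piece `(-1/4, -1/5]`
    have hA := lowUB_cap78_near h445 h8 le_rfl hp.le
    have hcap := lowUB_chord_half_78 (n := n) h8 hH hA (by linarith) (by linarith)
    have hfl := objE_floor_between hn0 hn2' (by norm_num : (-1 / 4 : ℝ) ≤ -1 / 5) rb rc hp.le ht2
    exact lowUB_doccN_lt_of_capUc_threshold (U₁ := 6) (Uc := 8) (by norm_num) (by norm_num) hU hn0 hn2' hcap hfl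
      (sub_min_lt_of
        (by nlinarith only [mul_nonneg (sub_nonneg.2 hn1) (sub_nonneg.2 (le_of_lt hp)), mul_nonneg (sub_nonneg.2 hn1) (sub_nonneg.2 ht2),
          mul_nonneg (sub_nonneg.2 hn2) (sub_nonneg.2 (le_of_lt hp)), mul_nonneg (sub_nonneg.2 hn2) (sub_nonneg.2 ht2), hsqU, hn1, hn2, (le_of_lt hp), ht2])
        (by nlinarith only [mul_nonneg (sub_nonneg.2 hn1) (sub_nonneg.2 (le_of_lt hp)), mul_nonneg (sub_nonneg.2 hn1) (sub_nonneg.2 ht2),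
          mul_nonneg (sub_nonneg.2 hn2) (sub_nonneg.2 (le_of_lt hp)), mul_nonneg (sub_nonneg.2 hn2) (sub_nonneg.2 ht2), hsqU, hn1, hn2, (le_of_lt hp), ht2]))

/-- **La₁.₇Sr₀.₃CuO₄ (column #50), OBJECT E `[5.9, 16.7] × [−0.23, −0.13] × [0.68, 0.72]` — MF/BCS class excluded from `U = 7`** (was `7.5`, `laE_x030_docc_lt_of`): `t′ ∈ [−1/4, −1/10]`, EVERY `U ≥ 7`, `n ∈ [17/25, 18/25]`; the strip `[5.9, 7)` of #50 is not covered by any device of record (exact margin `−0.003` at `6.5`). Caps at `U_c = 8`: chords `1/2 → 7/8` (#498, #445 near side) on `[−1/4, −3/20]` and `1/2 → 1` (#498, #472) on `[−3/20, −1/10]`; floor = tangent rows at `n₀ = 7/10`; smallest margin `+0.019`. [cite: KomaTasaki1994, §1] [cite: BachLiebSolovej1994, eq. (2c.36)] [cite: LiebLoss1993, §8, Theorem 8.2] -/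
theorem laLow_x030_docc_lt_of (h498 : cert_r498_qfp_U8_n1o2_tp0_upper) (h445 : cert_dbt329pair_allk)
    (h472 : cert_r472_pb2_tl_upper_n1_U8)
    {t' U n : ℝ} (ht1 : -1 / 4 ≤ t') (ht2 : t' ≤ -1 / 10) (hU : 7 ≤ U)
    (hn1 : 17 / 25 ≤ n) (hn2 : n ≤ 18 / 25) :
    ∀ (ω : InfVolFermionState 2) (Ls : ℕ → ℕ) (ψ : ∀ L, Fock (Orb (FermionTorus 2 L))),
      Tendsto Ls atTop atTop →
      (∀ j, IsGroundStateInSector (hubbardTorusTT' (Ls j) 1 t' U) (rectN n (Ls j)) 0 (ψ (Ls j))) →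
      (∀ j, star (ψ (Ls j)) ⬝ᵥ ψ (Ls j) = 1) → ω.IsTorusLimitOf ψ Ls →
      (ω.expect ({0} : Finset (Site 2))
        (nAt 0 (Finset.mem_singleton_self 0) 0 * nAt 0 (Finset.mem_singleton_self 0) 1)).re < (n / 2) ^ 2 := by
  have hn0 : (0 : ℝ) ≤ n := by linarith
  have hn2' : n < 2 := by linarith
  -- the class constant `(n/2)²` above its tangent at the lower band edge, scaled by the threshold
  have hsq : (-289 / 2500 : ℝ) + 17 / 50 * n ≤ (n / 2) ^ 2 := by nlinarith [sq_nonneg (n - 17 / 25)]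
  have hsqU : ((-289 / 2500 : ℝ) + 17 / 50 * n) * (7) ≤ (n / 2) ^ 2 * (7) :=
    mul_le_mul_of_nonneg_right hsq (by norm_num)
  have h8 : (0 : ℝ) ≤ 8 := by norm_num
  have hH := lowUB_quarter_cap h498 h8 le_rfl (by linarith : t' ≤ 0)
  have hC := objE_halfFilling_cap8 h472 t'
  have hA := lowUB_cap78_near h445 h8 le_rfl ht1
  have ra := fermiSeaTangentRow_tPrime_neg_one_div_four_at_seven_div_ten (U := 0) le_rfl hn0 hn2'
  have rb := fermiSeaTangentRow_tPrime_neg_one_div_five_at_seven_div_ten (U := 0) le_rfl hn0 hn2'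
  have rc := fermiSeaTangentRow_tPrime_neg_three_div_twenty_at_seven_div_ten (U := 0) le_rfl hn0 hn2'
  have rd := fermiSeaTangentRow_tPrime_neg_one_div_ten_at_seven_div_ten (U := 0) le_rfl hn0 hn2'
  rcases le_or_gt t' (-1 / 5) with hp | hp
  · -- piece `[-1/4, -1/5]`: chord `1/2 → 7/8`
    have hcap := lowUB_chord_half_78 (n := n) h8 hH hA (by linarith) (by linarith)
    have hfl := objE_floor_between hn0 hn2' (by norm_num : (-1 / 4 : ℝ) ≤ -1 / 5) ra rb ht1 hp
    exact lowUB_doccN_lt_of_capUc_threshold (U₁ := 7) (Uc := 8) (by norm_num) (by norm_num) hU hn0 hn2' hcap hfl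
      (sub_min_lt_of
        (by nlinarith only [mul_nonneg (sub_nonneg.2 hn1) (sub_nonneg.2 ht1), mul_nonneg (sub_nonneg.2 hn1) (sub_nonneg.2 hp),
          mul_nonneg (sub_nonneg.2 hn2) (sub_nonneg.2 ht1), mul_nonneg (sub_nonneg.2 hn2) (sub_nonneg.2 hp), hsqU, hn1, hn2, ht1, hp])
        (by nlinarith only [mul_nonneg (sub_nonneg.2 hn1) (sub_nonneg.2 ht1), mul_nonneg (sub_nonneg.2 hn1) (sub_nonneg.2 hp),
          mul_nonneg (sub_nonneg.2 hn2) (sub_nonneg.2 ht1), mul_nonneg (sub_nonneg.2 hn2) (sub_nonneg.2 hp), hsqU, hn1, hn2, ht1, hp]))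
  rcases le_or_gt t' (-3 / 20) with hq | hq
  · -- piece `(-1/5, -3/20]`: chord `1/2 → 7/8`
    have hcap := lowUB_chord_half_78 (n := n) h8 hH hA (by linarith) (by linarith)
    have hfl := objE_floor_between hn0 hn2' (by norm_num : (-1 / 5 : ℝ) ≤ -3 / 20) rb rc hp.le hq
    exact lowUB_doccN_lt_of_capUc_threshold (U₁ := 7) (Uc := 8) (by norm_num) (by norm_num) hU hn0 hn2' hcap hfl
      (sub_min_lt_of
        (by nlinarith only [mul_nonneg (sub_nonneg.2 hn1) (sub_nonneg.2 (le_of_lt hp)), mul_nonneg (sub_nonneg.2 hn1) (sub_nonneg.2 hq),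
          mul_nonneg (sub_nonneg.2 hn2) (sub_nonneg.2 (le_of_lt hp)), mul_nonneg (sub_nonneg.2 hn2) (sub_nonneg.2 hq), hsqU, hn1, hn2, (le_of_lt hp), hq])
        (by nlinarith only [mul_nonneg (sub_nonneg.2 hn1) (sub_nonneg.2 (le_of_lt hp)), mul_nonneg (sub_nonneg.2 hn1) (sub_nonneg.2 hq),
          mul_nonneg (sub_nonneg.2 hn2) (sub_nonneg.2 (le_of_lt hp)), mul_nonneg (sub_nonneg.2 hn2) (sub_nonneg.2 hq), hsqU, hn1, hn2, (le_of_lt hp), hq]))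
  · -- piece `(-3/20, -1/10]`: chord `1/2 → 1`
    have hcap := lowUB_chord_half_one (n := n) h8 hH hC (by linarith) (by linarith)
    have hfl := objE_floor_between hn0 hn2' (by norm_num : (-3 / 20 : ℝ) ≤ -1 / 10) rc rd hq.le ht2
    exact lowUB_doccN_lt_of_capUc_threshold (U₁ := 7) (Uc := 8) (by norm_num) (by norm_num) hU hn0 hn2' hcap hfl
      (sub_min_lt_of
        (by nlinarith only [mul_nonneg (sub_nonneg.2 hn1) (sub_nonneg.2 (le_of_lt hq)), mul_nonneg (sub_nonneg.2 hn1) (sub_nonneg.2 ht2),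
          mul_nonneg (sub_nonneg.2 hn2) (sub_nonneg.2 (le_of_lt hq)), mul_nonneg (sub_nonneg.2 hn2) (sub_nonneg.2 ht2), hsqU, hn1, hn2, (le_of_lt hq), ht2])
        (by nlinarith only [mul_nonneg (sub_nonneg.2 hn1) (sub_nonneg.2 (le_of_lt hq)), mul_nonneg (sub_nonneg.2 hn1) (sub_nonneg.2 ht2),
          mul_nonneg (sub_nonneg.2 hn2) (sub_nonneg.2 (le_of_lt hq)), mul_nonneg (sub_nonneg.2 hn2) (sub_nonneg.2 ht2), hsqU, hn1, hn2, (le_of_lt hq), ht2]))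

end Summit.Ventures.CertifiedManyBodySolver.Observables

end
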